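import Literature.Computability.Cryptography.PeriodFindingKernelShift
import HarnessLib

/-!
# Nested digit kernels: exact energy and per-coordinate window tails

Topic `Computability/Cryptography` (harmonic analysis of period finding); theorem-only file, no named facts.
Sequel of `PeriodFindingKernelShift.lean`.

When a register holding `T` digits in base `M` (value `E = ∑_t e_t M^t`) is Fourier-sampled at the frequency `ν < M^T`,
digit `t` sees the angle `ν/M^{T−t}` (mod 1): the leading contribution is the digit `ν_{T−1−t}` of `ν`, the lower digits of
`ν` only add a small KNOWN offset. For base angles `x_t` the amplitude is the NESTED product of one-dimensional kernels
`F(ν) = ∏_{t<T} D_M(x_t + ν/M^{T−t})`, `D_M(y) = ∑_{m<M} e(y m)`. Peeling the lowest digit of `ν` (`ν = ν₀ + M ν'`) turns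
`F_{T+1}(x; ν)` into `D_M(x_T + ν₀/M) · F_T(x'; ν')` with shifted base angles `x'_t = x_t + ν₀/M^{T+1−t}`, so the twisted
Parseval identity of the previous file gives, level by level:

* `sum_norm_sq_nested` — `∑_{ν<M^T} |F(ν)|² = M^{2T}` EXACTLY, for all base angles;
* `sum_norm_sq_nested_offWindow` — for each coordinate `t₀`, the energy at the frequencies whose angle in coordinate `t₀`
  is `u` or more grid steps (`1/M`) away from an integer is `≤ M^{2T}/(u − 2)`.

So each measured digit is within `u` grid steps of its peak except with probability `≤ 1/(u−2)`, whatever the other digits do.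

## References

* A. Yu. Kitaev, arXiv:quant-ph/9511026 (1995), §4. [Kitaev1995]
* S. Hallgren, STOC 2005, §4 (sampling over `ℤ^k`). [Hallgren2005]
-/

noncomputable section

namespace Literature.Computability.Cryptography

namespace PeriodFinding

open Complex Finset Real

/-- Splitting the frequency `ν = ν₀ + M ν'`: the angle of coordinate `t ≤ T` at level `T + 1` is the angle of the same
coordinate at level `T` for `ν'`, shifted by `ν₀/M^{T+1−t}`. [folklore] -/
theorem angle_split (M : ℕ) (hM : 0 < M) {T t : ℕ} (ht : t ≤ T) (ν₀ ν' : ℕ) :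
    ((ν₀ + M * ν' : ℕ) : ℝ) / (M : ℝ) ^ (T + 1 - t) = (ν₀ : ℝ) / (M : ℝ) ^ (T + 1 - t) + (ν' : ℝ) / (M : ℝ) ^ (T - t) := by
  have hM' : (M : ℝ) ≠ 0 := by exact_mod_cast hM.ne'
  rw [show T + 1 - t = (T - t) + 1 by omega, pow_succ]
  field_simp
  push_cast
  ring

/-- **Exact energy of nested digit kernels**: `∑_{ν<M^T} |∏_{t<T} D_M(x_t + ν/M^{T−t})|² = M^{2T}`.
[cite: Kitaev1995, §4] -/
theorem sum_norm_sq_nested (M : ℕ) (hM : 0 < M) : ∀ (T : ℕ) (x : ℕ → ℝ),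
    ∑ ν ∈ range (M ^ T), ‖∏ t ∈ range T, ∑ m ∈ range M, e1 (x t + (ν : ℝ) / (M : ℝ) ^ (T - t)) m‖ ^ 2 =
      (M : ℝ) ^ (2 * T) := by
  intro T
  induction T with
  | zero => intro x; simp
  | succ T ih =>
    intro x
    rw [pow_succ, mul_comm (M ^ T) M, sum_range_mul_blocks M (M ^ T)]
    -- peel the lowest digit
    have hpeel : ∀ ν' ∈ range (M ^ T), ∀ ν₀ ∈ range M,
        ‖∏ t ∈ range (T + 1), ∑ m ∈ range M, e1 (x t + ((ν₀ + M * ν' : ℕ) : ℝ) / (M : ℝ) ^ (T + 1 - t)) m‖ ^ 2 =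
          ‖∑ m ∈ range M, e1 (x T + (ν₀ : ℝ) / M) m‖ ^ 2 *
            ‖∏ t ∈ range T, ∑ m ∈ range M,
              e1 ((fun t => x t + (ν₀ : ℝ) / (M : ℝ) ^ (T + 1 - t)) t + (ν' : ℝ) / (M : ℝ) ^ (T - t)) m‖ ^ 2 := by
      intro ν' _ ν₀ _
      rw [prod_range_succ, norm_mul, mul_pow, mul_comm]
      congr 2
      · rw [angle_split M hM le_rfl, Nat.sub_self, pow_zero, div_one, Nat.add_sub_cancel_left, pow_one, ← add_assoc]
        exact congrArg (‖·‖) (kernel_add_int M _ ν')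
      · congr 1
        refine prod_congr rfl fun t ht => ?_
        rw [angle_split M hM (mem_range.1 ht).le, add_assoc]
    rw [sum_congr rfl fun ν' hν' => sum_congr rfl fun ν₀ hν₀ => hpeel ν' hν' ν₀ hν₀]
    rw [sum_comm]
    simp_rw [← mul_sum]
    rw [sum_congr rfl fun ν₀ _ => by rw [ih]]
    rw [← sum_mul, sum_norm_sq_kernel_shift M hM (x T)]
    ring

/-- **Per-coordinate window tail of nested digit kernels**: for `t₀ < T` and `u ≥ 3`, the energy at the frequencies
`ν < M^T` whose coordinate-`t₀` angle `x_{t₀} + ν/M^{T−t₀}` is at least `u` grid steps `1/M` from an integer is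
`≤ M^{2T}/(u−2)`. [cite: Kitaev1995, §4] -/
theorem sum_norm_sq_nested_offWindow (M : ℕ) (hM : 0 < M) {u : ℕ} (hu : 3 ≤ u) : ∀ (T : ℕ) (x : ℕ → ℝ) (t₀ : ℕ),
    t₀ < T →
    ∑ ν ∈ (range (M ^ T)).filter (fun ν : ℕ => (u : ℝ) ≤ M *
        min (Int.fract (x t₀ + (ν : ℝ) / (M : ℝ) ^ (T - t₀))) (1 - Int.fract (x t₀ + (ν : ℝ) / (M : ℝ) ^ (T - t₀)))),
      ‖∏ t ∈ range T, ∑ m ∈ range M, e1 (x t + (ν : ℝ) / (M : ℝ) ^ (T - t)) m‖ ^ 2 ≤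
      (M : ℝ) ^ (2 * T) / (u - 2) := by
  intro T
  induction T with
  | zero => intro x t₀ h; omega
  | succ T ih =>
    intro x t₀ ht₀
    have hu2 : (0 : ℝ) < (u : ℝ) - 2 := by
      have : (3 : ℝ) ≤ u := by exact_mod_cast hu
      linarith
    rw [sum_filter, pow_succ, mul_comm (M ^ T) M, sum_range_mul_blocks M (M ^ T)]
    -- the shifted base angles after peeling `ν₀`
    set x' : ℕ → ℕ → ℝ := fun ν₀ t => x t + (ν₀ : ℝ) / (M : ℝ) ^ (T + 1 - t) with hx'
    have hpeel : ∀ ν' ∈ range (M ^ T), ∀ ν₀ ∈ range M,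
        ‖∏ t ∈ range (T + 1), ∑ m ∈ range M, e1 (x t + ((ν₀ + M * ν' : ℕ) : ℝ) / (M : ℝ) ^ (T + 1 - t)) m‖ ^ 2 =
          ‖∑ m ∈ range M, e1 (x T + (ν₀ : ℝ) / M) m‖ ^ 2 *
            ‖∏ t ∈ range T, ∑ m ∈ range M, e1 (x' ν₀ t + (ν' : ℝ) / (M : ℝ) ^ (T - t)) m‖ ^ 2 := by
      intro ν' _ ν₀ _
      rw [prod_range_succ, norm_mul, mul_pow, mul_comm]
      congr 2
      · rw [angle_split M hM le_rfl, Nat.sub_self, pow_zero, div_one, Nat.add_sub_cancel_left, pow_one, ← add_assoc]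
        exact congrArg (‖·‖) (kernel_add_int M _ ν')
      · congr 1
        refine prod_congr rfl fun t ht => ?_
        rw [angle_split M hM (mem_range.1 ht).le, hx', add_assoc]
    rcases Nat.lt_succ_iff_lt_or_eq.1 ht₀ with hlt | heq
    · -- `t₀ < T`: the window condition is the level-`T` condition for `x' ν₀`, `ν'`
      have hcond : ∀ ν' ν₀ : ℕ,
          ((u : ℝ) ≤ M * min (Int.fract (x t₀ + ((ν₀ + M * ν' : ℕ) : ℝ) / (M : ℝ) ^ (T + 1 - t₀)))
              (1 - Int.fract (x t₀ + ((ν₀ + M * ν' : ℕ) : ℝ) / (M : ℝ) ^ (T + 1 - t₀)))) ↔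
          ((u : ℝ) ≤ M * min (Int.fract (x' ν₀ t₀ + (ν' : ℝ) / (M : ℝ) ^ (T - t₀)))
              (1 - Int.fract (x' ν₀ t₀ + (ν' : ℝ) / (M : ℝ) ^ (T - t₀)))) := by
        intro ν' ν₀
        rw [angle_split M hM hlt.le, hx', add_assoc]
      calc _ = ∑ ν₀ ∈ range M, ‖∑ m ∈ range M, e1 (x T + (ν₀ : ℝ) / M) m‖ ^ 2 *
            ∑ ν' ∈ (range (M ^ T)).filter (fun ν' : ℕ => (u : ℝ) ≤ M *
              min (Int.fract (x' ν₀ t₀ + (ν' : ℝ) / (M : ℝ) ^ (T - t₀)))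
                (1 - Int.fract (x' ν₀ t₀ + (ν' : ℝ) / (M : ℝ) ^ (T - t₀)))),
              ‖∏ t ∈ range T, ∑ m ∈ range M, e1 (x' ν₀ t + (ν' : ℝ) / (M : ℝ) ^ (T - t)) m‖ ^ 2 := by
            rw [sum_comm]
            refine sum_congr rfl fun ν₀ hν₀ => ?_
            rw [sum_filter, mul_sum]
            refine sum_congr rfl fun ν' hν' => ?_
            by_cases h : (u : ℝ) ≤ M * min (Int.fract (x t₀ + ((ν₀ + M * ν' : ℕ) : ℝ) / (M : ℝ) ^ (T + 1 - t₀)))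
                (1 - Int.fract (x t₀ + ((ν₀ + M * ν' : ℕ) : ℝ) / (M : ℝ) ^ (T + 1 - t₀)))
            · rw [if_pos h, if_pos ((hcond ν' ν₀).1 h), hpeel ν' hν' ν₀ hν₀]
            · rw [if_neg h, if_neg (fun h' => h ((hcond ν' ν₀).2 h')), mul_zero]
        _ ≤ ∑ ν₀ ∈ range M, ‖∑ m ∈ range M, e1 (x T + (ν₀ : ℝ) / M) m‖ ^ 2 * ((M : ℝ) ^ (2 * T) / (u - 2)) := by
            refine sum_le_sum fun ν₀ _ => ?_
            exact mul_le_mul_of_nonneg_left (ih (x' ν₀) t₀ hlt) (by positivity)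
        _ = (M : ℝ) ^ (2 * (T + 1)) / (u - 2) := by
            rw [← sum_mul, sum_norm_sq_kernel_shift M hM (x T)]
            ring
    · -- `t₀ = T`: the window condition only depends on `ν₀`
      subst heq
      have hcond : ∀ ν' ν₀ : ℕ,
          Int.fract (x t₀ + ((ν₀ + M * ν' : ℕ) : ℝ) / (M : ℝ) ^ (t₀ + 1 - t₀)) = Int.fract (x t₀ + (ν₀ : ℝ) / M) := by
        intro ν' ν₀
        rw [angle_split M hM le_rfl, Nat.sub_self, pow_zero, div_one, Nat.add_sub_cancel_left, pow_one, ← add_assoc,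
          Int.fract_add_natCast]
      calc _ = ∑ ν₀ ∈ (range M).filter (fun ν₀ : ℕ => (u : ℝ) ≤ M *
              min (Int.fract (x t₀ + (ν₀ : ℝ) / M)) (1 - Int.fract (x t₀ + (ν₀ : ℝ) / M))),
            ‖∑ m ∈ range M, e1 (x t₀ + (ν₀ : ℝ) / M) m‖ ^ 2 *
              ∑ ν' ∈ range (M ^ t₀), ‖∏ t ∈ range t₀, ∑ m ∈ range M, e1 (x' ν₀ t + (ν' : ℝ) / (M : ℝ) ^ (t₀ - t)) m‖ ^ 2 := by
            rw [sum_comm, sum_filter]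
            refine sum_congr rfl fun ν₀ hν₀ => ?_
            by_cases h : (u : ℝ) ≤ M * min (Int.fract (x t₀ + (ν₀ : ℝ) / M)) (1 - Int.fract (x t₀ + (ν₀ : ℝ) / M))
            · rw [if_pos h, mul_sum]
              refine sum_congr rfl fun ν' hν' => ?_
              have h1 : (u : ℝ) ≤ M * min (Int.fract (x t₀ + ((ν₀ + M * ν' : ℕ) : ℝ) / (M : ℝ) ^ (t₀ + 1 - t₀)))
                  (1 - Int.fract (x t₀ + ((ν₀ + M * ν' : ℕ) : ℝ) / (M : ℝ) ^ (t₀ + 1 - t₀))) := by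
                rw [hcond ν' ν₀]; exact h
              rw [if_pos h1, hpeel ν' hν' ν₀ hν₀]
            · rw [if_neg h]
              refine sum_eq_zero fun ν' _ => ?_
              have h1 : ¬ ((u : ℝ) ≤ M * min (Int.fract (x t₀ + ((ν₀ + M * ν' : ℕ) : ℝ) / (M : ℝ) ^ (t₀ + 1 - t₀)))
                  (1 - Int.fract (x t₀ + ((ν₀ + M * ν' : ℕ) : ℝ) / (M : ℝ) ^ (t₀ + 1 - t₀)))) := by
                rw [hcond ν' ν₀]; exact h
              rw [if_neg h1]
        _ = ∑ ν₀ ∈ (range M).filter (fun ν₀ : ℕ => (u : ℝ) ≤ M *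
              min (Int.fract (x t₀ + (ν₀ : ℝ) / M)) (1 - Int.fract (x t₀ + (ν₀ : ℝ) / M))),
            ‖∑ m ∈ range M, e1 (x t₀ + (ν₀ : ℝ) / M) m‖ ^ 2 * (M : ℝ) ^ (2 * t₀) := by
            refine sum_congr rfl fun ν₀ _ => ?_
            rw [sum_norm_sq_nested M hM t₀ (x' ν₀)]
        _ ≤ (M : ℝ) ^ 2 / (u - 2) * (M : ℝ) ^ (2 * t₀) := by
            rw [← sum_mul]
            exact mul_le_mul_of_nonneg_right (sum_norm_sq_kernel_shift_offWindow M hM (x t₀) hu) (by positivity)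
        _ = (M : ℝ) ^ (2 * (t₀ + 1)) / (u - 2) := by ring

/-! ### Counting the window -/

/-- **At most `2u` points of a shifted `1/M`-grid lie within `u` grid steps of an integer.** [folklore] -/
theorem card_window_le (M : ℕ) (hM : 0 < M) (x : ℝ) (u : ℕ) :
    ((range M).filter (fun ν : ℕ => (M : ℝ) * min (Int.fract (x + (ν : ℝ) / M)) (1 - Int.fract (x + (ν : ℝ) / M)) < u)).card
      ≤ 2 * u := by
  have hMR : (0 : ℝ) < M := by exact_mod_cast hM
  set s : ℕ := (⌊(M : ℝ) * x⌋ % (M : ℤ)).toNat with hs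
  set f₀ : ℝ := Int.fract ((M : ℝ) * x) with hf₀
  have hf₀0 : 0 ≤ f₀ := Int.fract_nonneg _
  have hf₀1 : f₀ < 1 := Int.fract_lt_one _
  -- as in `sum_norm_sq_kernel_shift_offWindow`: `fract (x + ν/M) = ((s + ν) % M + f₀)/M`
  have hfract : ∀ ν : ℕ, Int.fract (x + (ν : ℝ) / M) = ((((s + ν) % M : ℕ) : ℝ) + f₀) / M := by
    intro ν
    have hfl : ((⌊(M : ℝ) * x⌋ : ℤ) : ℝ) + f₀ = (M : ℝ) * x := by rw [hf₀]; exact Int.floor_add_fract _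
    have hx : x + (ν : ℝ) / M = (((⌊(M : ℝ) * x⌋ : ℤ) : ℝ) + ν + f₀) / M := by
      have hfl' : ((⌊x * (M : ℝ)⌋ : ℤ) : ℝ) + f₀ = x * M := by rw [mul_comm]; exact hfl
      field_simp
      linarith
    obtain ⟨q, hq⟩ : ∃ q : ℤ, (⌊(M : ℝ) * x⌋ : ℤ) + ν = (((s + ν) % M : ℕ) : ℤ) + M * q := by
      refine ⟨(⌊(M : ℝ) * x⌋ + ν) / M, ?_⟩
      have hsz : (s : ℤ) = ⌊(M : ℝ) * x⌋ % (M : ℤ) := by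
        rw [hs, Int.toNat_of_nonneg (Int.emod_nonneg _ (by exact_mod_cast hM.ne'))]
      have hmod : (((s + ν) % M : ℕ) : ℤ) = ((⌊(M : ℝ) * x⌋ + ν) % M) := by
        push_cast
        rw [hsz, Int.add_emod, Int.emod_emod_of_dvd _ (dvd_refl _), ← Int.add_emod]
      rw [hmod]
      exact (Int.emod_add_mul_ediv _ _).symm
    have hqR : ((⌊(M : ℝ) * x⌋ : ℤ) : ℝ) + ν = (((s + ν) % M : ℕ) : ℝ) + M * q := by
      have := congrArg (fun z : ℤ => (z : ℝ)) hq
      push_cast at this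
      exact this
    rw [hx, show (((⌊(M : ℝ) * x⌋ : ℤ) : ℝ) + ν + f₀) / M = ((((s + ν) % M : ℕ) : ℝ) + f₀) / M + (q : ℝ) by
      field_simp; linarith]
    rw [Int.fract_add_intCast, Int.fract_eq_self.2]
    constructor
    · positivity
    · rw [div_lt_one hMR]
      have h1 : (((s + ν) % M : ℕ) : ℝ) + 1 ≤ M := by exact_mod_cast (show (s + ν) % M + 1 ≤ M from Nat.mod_lt _ hM)
      linarith
  -- the condition as a predicate of `r = (s + ν) % M`: it forces `r < u ∨ M - u ≤ r`
  set P : ℕ → Prop := fun r => (M : ℝ) * min ((((r : ℕ) : ℝ) + f₀) / M) (1 - (((r : ℕ) : ℝ) + f₀) / M) < u with hP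
  have hiff : ∀ ν : ℕ, ((M : ℝ) * min (Int.fract (x + (ν : ℝ) / M)) (1 - Int.fract (x + (ν : ℝ) / M)) < u) ↔
      P ((s + ν) % M) := by
    intro ν; simp only [hP, hfract ν]
  have hPimp : ∀ r < M, P r → r < u ∨ M - u ≤ r := by
    intro r hrM hr
    simp only [hP] at hr
    rw [mul_min_of_nonneg _ _ hMR.le, min_lt_iff] at hr
    rcases hr with h | h
    · left
      have : (M : ℝ) * ((((r : ℕ) : ℝ) + f₀) / M) = r + f₀ := by field_simp
      have : (r : ℝ) < u := by linarith
      exact_mod_cast this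
    · right
      have : (M : ℝ) * (1 - (((r : ℕ) : ℝ) + f₀) / M) = M - (r + f₀) := by field_simp
      have h' : (M : ℝ) - r < u + 1 := by linarith
      have : M - r < u + 1 := by
        have hc : ((M - r : ℕ) : ℝ) = (M : ℝ) - r := by rw [Nat.cast_sub hrM.le]
        exact_mod_cast (show ((M - r : ℕ) : ℝ) < ((u + 1 : ℕ) : ℝ) by push_cast; rw [hc]; exact h')
      omega
  -- count through the bijection `ν ↦ (s + ν) % M` of `range M`
  classical
  calc ((range M).filter (fun ν : ℕ => (M : ℝ) * min (Int.fract (x + (ν : ℝ) / M)) (1 - Int.fract (x + (ν : ℝ) / M)) < u)).card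
      = ((range M).filter (fun ν : ℕ => P ((s + ν) % M))).card := by
        congr 1; exact filter_congr fun ν _ => hiff ν
    _ = ∑ ν ∈ range M, (if P ((s + ν) % M) then 1 else 0) := by rw [card_filter]
    _ = ∑ r ∈ range M, (if P r then 1 else 0) := sum_range_shift hM s (fun r => if P r then 1 else 0)
    _ = ((range M).filter P).card := by rw [card_filter]
    _ ≤ ((range M).filter (fun r => r < u ∨ M - u ≤ r)).card := by
        apply card_le_card
        intro r hr
        have h := mem_filter.1 hr
        exact mem_filter.2 ⟨h.1, hPimp r (mem_range.1 h.1) h.2⟩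
    _ ≤ ((range M).filter (fun r => r < u)).card + ((range M).filter (fun r => M - u ≤ r)).card := by
        rw [filter_or]; exact card_union_le _ _
    _ ≤ u + u := by
        apply add_le_add
        · calc ((range M).filter (fun r => r < u)).card ≤ (range u).card := by
                apply card_le_card; intro r hr; have h := mem_filter.1 hr; exact mem_range.2 h.2
            _ = u := card_range u
        · calc ((range M).filter (fun r => M - u ≤ r)).card ≤ (Ico (M - u) M).card := by
                apply card_le_card; intro r hr; have h := mem_filter.1 hr
                exact mem_Ico.2 ⟨h.2, mem_range.1 h.1⟩
            _ = M - (M - u) := Nat.card_Ico _ _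
            _ ≤ u := by omega
    _ = 2 * u := by ring

/-- **The nested window is small**: the number of frequencies `ν < M^T` all of whose coordinate angles
`x_t + ν/M^{T−t}` (`t < T`) are within `u` grid steps of an integer is `≤ (2u)^T`. [folklore] -/
theorem card_nestedWindow_le (M : ℕ) (hM : 0 < M) (u : ℕ) : ∀ (T : ℕ) (x : ℕ → ℝ),
    ((range (M ^ T)).filter (fun ν : ℕ => ∀ t < T, (M : ℝ) *
        min (Int.fract (x t + (ν : ℝ) / (M : ℝ) ^ (T - t))) (1 - Int.fract (x t + (ν : ℝ) / (M : ℝ) ^ (T - t))) < u)).card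
      ≤ (2 * u) ^ T := by
  intro T
  induction T with
  | zero => intro x; simp
  | succ T ih =>
    intro x
    classical
    set x' : ℕ → ℕ → ℝ := fun ν₀ t => x t + (ν₀ : ℝ) / (M : ℝ) ^ (T + 1 - t) with hx'
    -- the level-`T+1` window of `ν = ν₀ + M ν'` is: coordinate `T` in window for `ν₀`, and the level-`T` window for `x' ν₀`, `ν'`
    have hsplit : ∀ ν₀ ν' : ℕ, (∀ t < T + 1, (M : ℝ) *
        min (Int.fract (x t + ((ν₀ + M * ν' : ℕ) : ℝ) / (M : ℝ) ^ (T + 1 - t)))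
          (1 - Int.fract (x t + ((ν₀ + M * ν' : ℕ) : ℝ) / (M : ℝ) ^ (T + 1 - t))) < u) ↔
        ((M : ℝ) * min (Int.fract (x T + (ν₀ : ℝ) / M)) (1 - Int.fract (x T + (ν₀ : ℝ) / M)) < u ∧
          ∀ t < T, (M : ℝ) * min (Int.fract (x' ν₀ t + (ν' : ℝ) / (M : ℝ) ^ (T - t)))
            (1 - Int.fract (x' ν₀ t + (ν' : ℝ) / (M : ℝ) ^ (T - t))) < u) := by
      intro ν₀ ν'
      have hT : Int.fract (x T + ((ν₀ + M * ν' : ℕ) : ℝ) / (M : ℝ) ^ (T + 1 - T)) = Int.fract (x T + (ν₀ : ℝ) / M) := by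
        rw [angle_split M hM le_rfl, Nat.sub_self, pow_zero, div_one, Nat.add_sub_cancel_left, pow_one, ← add_assoc,
          Int.fract_add_natCast]
      have ht : ∀ t < T, x t + ((ν₀ + M * ν' : ℕ) : ℝ) / (M : ℝ) ^ (T + 1 - t) = x' ν₀ t + (ν' : ℝ) / (M : ℝ) ^ (T - t) := by
        intro t ht
        rw [angle_split M hM ht.le, hx', add_assoc]
      constructor
      · intro h
        refine ⟨by simpa only [hT] using h T (Nat.lt_succ_self T), fun t ht' => ?_⟩
        rw [← ht t ht']; exact h t (Nat.lt_succ_of_lt ht')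
      · rintro ⟨h1, h2⟩ t ht'
        rcases Nat.lt_succ_iff_lt_or_eq.1 ht' with hlt | rfl
        · rw [ht t hlt]; exact h2 t hlt
        · rw [hT]; exact h1
    -- count
    have hcount : ((range (M ^ (T + 1))).filter (fun ν : ℕ => ∀ t < T + 1, (M : ℝ) *
        min (Int.fract (x t + (ν : ℝ) / (M : ℝ) ^ (T + 1 - t))) (1 - Int.fract (x t + (ν : ℝ) / (M : ℝ) ^ (T + 1 - t))) < u)).card
        = ∑ ν₀ ∈ range M, if (M : ℝ) * min (Int.fract (x T + (ν₀ : ℝ) / M)) (1 - Int.fract (x T + (ν₀ : ℝ) / M)) < u then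
            ((range (M ^ T)).filter (fun ν' : ℕ => ∀ t < T, (M : ℝ) *
              min (Int.fract (x' ν₀ t + (ν' : ℝ) / (M : ℝ) ^ (T - t)))
                (1 - Int.fract (x' ν₀ t + (ν' : ℝ) / (M : ℝ) ^ (T - t))) < u)).card else 0 := by
      rw [card_filter, pow_succ, mul_comm (M ^ T) M, sum_range_mul_blocks M (M ^ T), sum_comm]
      refine sum_congr rfl fun ν₀ _ => ?_
      by_cases h : (M : ℝ) * min (Int.fract (x T + (ν₀ : ℝ) / M)) (1 - Int.fract (x T + (ν₀ : ℝ) / M)) < u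
      · rw [if_pos h, card_filter]
        refine sum_congr rfl fun ν' _ => ?_
        by_cases h' : ∀ t < T, (M : ℝ) * min (Int.fract (x' ν₀ t + (ν' : ℝ) / (M : ℝ) ^ (T - t)))
            (1 - Int.fract (x' ν₀ t + (ν' : ℝ) / (M : ℝ) ^ (T - t))) < u
        · rw [if_pos h', if_pos ((hsplit ν₀ ν').2 ⟨h, h'⟩)]
        · rw [if_neg h', if_neg (fun h'' => h' ((hsplit ν₀ ν').1 h'').2)]
      · rw [if_neg h]
        refine sum_eq_zero fun ν' _ => ?_
        rw [if_neg (fun h'' => h ((hsplit ν₀ ν').1 h'').1)]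
    rw [hcount]
    calc _ ≤ ∑ ν₀ ∈ range M, (if (M : ℝ) * min (Int.fract (x T + (ν₀ : ℝ) / M)) (1 - Int.fract (x T + (ν₀ : ℝ) / M)) < u
          then (2 * u) ^ T else 0) := by
          refine sum_le_sum fun ν₀ _ => ?_
          split_ifs
          · exact ih (x' ν₀)
          · exact le_rfl
      _ = ((range M).filter (fun ν₀ : ℕ => (M : ℝ) * min (Int.fract (x T + (ν₀ : ℝ) / M))
            (1 - Int.fract (x T + (ν₀ : ℝ) / M)) < u)).card * (2 * u) ^ T := by
          rw [← sum_filter, sum_const, smul_eq_mul]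
      _ ≤ (2 * u) * (2 * u) ^ T := Nat.mul_le_mul_right _ (card_window_le M hM (x T) u)
      _ = (2 * u) ^ (T + 1) := by ring

end PeriodFinding

end Literature.Computability.Cryptography
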